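import Summits.RiemannHypothesis.RiemannHypothesis.Theorems.ThetaTier2Stage1
import HarnessLib

/-!
# THETA tier-2 kernel checker — soundness of STAGE 2: the two `L²` cell sums, the arch bound, the `C_T` prime part (cc-s2-1; RH-FREE)

(K2)/(K3) of HOME/cc-s2-1/gen22/TIER2-KERNEL-SPEC.md §5 / §6(b).  With the exported cell envelopes `envE A j`, `envEp A j` (ThetaTier2Stage1)
and ANY reals enclosed by the atoms (`ū₁ ≤ val u1H`, `0 ≤ τ̄ ≤ val tau`, `0 ≤ M̄₀ ≤ val M0`, `0 ≤ M̄ ≤ val Mbar`, `0 ≤ M̄₁ ≤ val Mbar1`,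
`0 ≤ E₁ ≤ val eD2m1`, `0 ≤ E₂ ≤ val eD2m`, `0 ≤ E₃ ≤ val eD2m_1`, …) the four outputs of `stage2 A (stage1 A)` dominate

  (K2)  `2ū₁·[τ̄·M̄₀²·Σ_{j<Jt} (envE A j)² + M̄²E₁/(2m+1)] ≤ val Ahi`,
        `2ū₁·[τ̄·Σ_{j<Jt} (envEp A j)² + (M̄²/4)E₁/(2m+1) + M̄M̄₁E₂/(2m) + M̄₁²E₃/(2m−1)] ≤ val Bhi`,
  (K3)  `B̄·ē·t̄₀²/4 + Ā·c̄_A ≤ val arch` (any `0 ≤ B̄ ≤ val Bhi`, `0 ≤ Ā ≤ val Ahi`),  `4M̄²ū₁/(2m+1)·Λ̄ ≤ val primesC`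

— the right-hand sides of THETA-CERT-cc6 E3 (in the shape of weil-1's `WeilColumnThetaCellNorms.integral_sq_le_cellSum_add_tail`), D7 and D6.
Ingredients: `sumSq` is an upper sum of squares (`sumSq_sound`), the range-sum/list-sum identity for `getD`, and the monotone transfer lemmas of
ThetaTier2Round.  Nothing here bears on the truth of RH.
-/

set_option linter.dupNamespace false  -- the mandated namespace repeats `RiemannHypothesis`
set_option autoImplicit false

namespace Summit.RiemannHypothesis.RiemannHypothesis.Theorems.ThetaTier2

open Real Finset

/-! ## `sumSq` -/

/-- `sumSq [] acc = acc`. [this cell] -/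
theorem sumSq_nil (acc : ℕ) : sumSq [] acc = acc := by
  unfold sumSq; rfl

/-- `sumSq (e :: es) acc = sumSq es (acc + mulU e e)`. [this cell] -/
theorem sumSq_cons (e : ℕ) (es : List ℕ) (acc : ℕ) : sumSq (e :: es) acc = sumSq es (acc + mulU e e) := by
  conv => lhs; unfold sumSq

/-- **`sumSq` rounds the sum of squares UP**: `val acc + Σ_{e ∈ l} (val e)² ≤ val (sumSq l acc)`. [this cell, TIER2-KERNEL-SPEC §2] -/
theorem sumSq_sound : ∀ (l : List ℕ) (acc : ℕ), val acc + (l.map fun e => val e ^ 2).sum ≤ val (sumSq l acc) := by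
  intro l
  induction l with
  | nil => intro acc; rw [sumSq_nil]; simp
  | cons e es ih =>
    intro acc
    rw [sumSq_cons, List.map_cons, List.sum_cons]
    have h := ih (acc + mulU e e)
    rw [val_add] at h
    have hsq : val e ^ 2 ≤ val (mulU e e) := by rw [sq]; exact le_mulU (val_nonneg e) le_rfl le_rfl
    linarith

/-- Range sums over `getD` are list sums: `Σ_{j < |l|} f (l.getD j d) = (l.map f).sum`. [folklore] -/
theorem sum_range_getD {α : Type*} (f : α → ℝ) (d : α) :
    ∀ l : List α, ∑ j ∈ range l.length, f (l.getD j d) = (l.map f).sum := by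
  intro l
  induction l with
  | nil => simp
  | cons x xs ih =>
    rw [List.length_cons, sum_range_succ', List.map_cons, List.sum_cons]
    simp only [List.getD_cons_succ, List.getD_cons_zero]
    rw [ih, add_comm]

/-- The sum of squares over the re-reversed list (forward cell order) is bounded by `sumSq` of the reversed accumulator. [this cell] -/
theorem sum_sq_reverse_le_sumSq (l : List ℕ) :
    ∑ j ∈ range l.length, val (l.reverse.getD j 0) ^ 2 ≤ val (sumSq l 0) := by
  have h := sumSq_sound l 0
  rw [val_zero, zero_add] at h
  have e1 : ∑ j ∈ range l.length, val (l.reverse.getD j 0) ^ 2 = (l.map fun e => val e ^ 2).sum := by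
    rw [← List.length_reverse, sum_range_getD (fun e => val e ^ 2) 0 l.reverse, List.map_reverse, List.sum_reverse]
  rw [e1]; exact h

/-- **`Σ_{j<Jt} (envE A j)² ≤ val (sumSq (stage1 A).eRev 0)`.** [this cell, TIER2-KERNEL-SPEC §5 (K2)] -/
theorem sum_envE_sq_le (A : Inp) : ∑ j ∈ range A.Jt, envE A j ^ 2 ≤ val (sumSq (stage1 A).eRev 0) := by
  have h := sum_sq_reverse_le_sumSq (stage1 A).eRev
  rw [(stage1_lengths A).2.1] at h
  exact h

/-- **`Σ_{j<Jt} (envEp A j)² ≤ val (sumSq (stage1 A).epRev 0)`.** [this cell, TIER2-KERNEL-SPEC §5 (K2)] -/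
theorem sum_envEp_sq_le (A : Inp) : ∑ j ∈ range A.Jt, envEp A j ^ 2 ≤ val (sumSq (stage1 A).epRev 0) := by
  have h := sum_sq_reverse_le_sumSq (stage1 A).epRev
  rw [(stage1_lengths A).2.2] at h
  exact h

/-! ## The four fields of `stage2` as explicit expressions -/

/-- `stage2`'s `Ahi`. [this cell] -/
theorem stage2_Ahi (A : Inp) (st : St) : (stage2 A st).Ahi =
    mulU (2 * A.u1H) (mulU (mulU A.tau (mulU A.M0 A.M0)) (sumSq st.eRev 0)
      + divUn (mulU (mulU A.Mbar A.Mbar) A.eD2m1) (2 * A.m + 1)) := by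
  unfold stage2; dsimp only

/-- `stage2`'s `Bhi`. [this cell] -/
theorem stage2_Bhi (A : Inp) (st : St) : (stage2 A st).Bhi =
    mulU (2 * A.u1H) (mulU A.tau (sumSq st.epRev 0)
      + (divUn (mulU (divUn (mulU A.Mbar A.Mbar) 4) A.eD2m1) (2 * A.m + 1)
        + divUn (mulU (mulU A.Mbar A.Mbar1) A.eD2m) (2 * A.m)
        + divUn (mulU (mulU A.Mbar1 A.Mbar1) A.eD2m_1) (2 * A.m - 1))) := by
  unfold stage2; dsimp only

/-- `stage2`'s `arch` in terms of its `Ahi`, `Bhi`. [this cell] -/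
theorem stage2_arch (A : Inp) (st : St) : (stage2 A st).arch =
    divUn (mulU (mulU (mulU (stage2 A st).Bhi A.et0half) A.t0) A.t0) 4 + mulU (stage2 A st).Ahi A.coefA := by
  unfold stage2; dsimp only

/-- `stage2`'s `primesC`. [this cell] -/
theorem stage2_primesC (A : Inp) (st : St) : (stage2 A st).primesC =
    mulU (divUn (mulU (4 * mulU A.Mbar A.Mbar) A.u1H) (2 * A.m + 1)) A.lamSum := by
  unfold stage2; dsimp only

/-! ## (K2): the two `L²` bounds -/

set_option maxHeartbeats 400000 in
/-- **(K2) for `A = ‖T⁻‖²`**: `2ū₁·[τ̄·M̄₀²·Σ_{j<Jt} (envE A j)² + M̄²E₁/(2m+1)] ≤ val Ahi`. [this cell, TIER2-KERNEL-SPEC §5 (K2); THETA-CERT-cc6 E3] -/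
theorem stage2_Ahi_sound (A : Inp) {u τr M0r Mb E1 : ℝ} (hu : u ≤ val A.u1H)
    (hτ0 : 0 ≤ τr) (hτ : τr ≤ val A.tau) (hM0 : 0 ≤ M0r) (hM : M0r ≤ val A.M0) (hMb0 : 0 ≤ Mb) (hMb : Mb ≤ val A.Mbar)
    (hE0 : 0 ≤ E1) (hE : E1 ≤ val A.eD2m1) :
    2 * u * (τr * M0r ^ 2 * ∑ j ∈ range A.Jt, envE A j ^ 2 + Mb ^ 2 * E1 / (2 * A.m + 1)) ≤
      val (stage2 A (stage1 A)).Ahi := by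
  rw [stage2_Ahi]
  have hS := sum_envE_sq_le A
  have hS0 : 0 ≤ ∑ j ∈ range A.Jt, envE A j ^ 2 := sum_nonneg fun j _ => sq_nonneg _
  have h1 : M0r ^ 2 ≤ val (mulU A.M0 A.M0) := by rw [sq]; exact le_mulU hM0 hM hM
  have h2 : τr * M0r ^ 2 ≤ val (mulU A.tau (mulU A.M0 A.M0)) := le_mulU (sq_nonneg _) hτ h1
  have h3 : τr * M0r ^ 2 * ∑ j ∈ range A.Jt, envE A j ^ 2 ≤
      val (mulU (mulU A.tau (mulU A.M0 A.M0)) (sumSq (stage1 A).eRev 0)) := le_mulU hS0 h2 hS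
  have h4 : Mb ^ 2 ≤ val (mulU A.Mbar A.Mbar) := by rw [sq]; exact le_mulU hMb0 hMb hMb
  have h5 : Mb ^ 2 * E1 ≤ val (mulU (mulU A.Mbar A.Mbar) A.eD2m1) := le_mulU hE0 h4 hE
  have h6 : Mb ^ 2 * E1 / (2 * A.m + 1) ≤ val (divUn (mulU (mulU A.Mbar A.Mbar) A.eD2m1) (2 * A.m + 1)) := by
    have := le_divUn h5 (show 0 < 2 * A.m + 1 by omega)
    push_cast at this; exact this
  have h7 : τr * M0r ^ 2 * ∑ j ∈ range A.Jt, envE A j ^ 2 + Mb ^ 2 * E1 / (2 * A.m + 1) ≤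
      val (mulU (mulU A.tau (mulU A.M0 A.M0)) (sumSq (stage1 A).eRev 0)
        + divUn (mulU (mulU A.Mbar A.Mbar) A.eD2m1) (2 * A.m + 1)) := by rw [val_add]; linarith
  have h8 : 2 * u ≤ val (2 * A.u1H) := by rw [val_nat_mul]; push_cast; linarith
  have hin0 : 0 ≤ τr * M0r ^ 2 * ∑ j ∈ range A.Jt, envE A j ^ 2 + Mb ^ 2 * E1 / (2 * A.m + 1) := by positivity
  exact le_mulU hin0 h8 h7

/-- **(K2) for `B = ‖(T⁻)′‖²`**: `2ū₁·[τ̄·Σ_{j<Jt} (envEp A j)² + (M̄²/4)E₁/(2m+1) + M̄M̄₁E₂/(2m) + M̄₁²E₃/(2m−1)] ≤ val Bhi` (`m ≥ 1`).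
[this cell, TIER2-KERNEL-SPEC §5 (K2); THETA-CERT-cc6 E3] -/
theorem stage2_Bhi_sound (A : Inp) (hm : 1 ≤ A.m) {u τr Mb Mb1 E1 E2 E3 : ℝ} (hu : u ≤ val A.u1H)
    (hτ0 : 0 ≤ τr) (hτ : τr ≤ val A.tau) (hMb0 : 0 ≤ Mb) (hMb : Mb ≤ val A.Mbar) (hMb10 : 0 ≤ Mb1) (hMb1 : Mb1 ≤ val A.Mbar1)
    (hE10 : 0 ≤ E1) (hE1 : E1 ≤ val A.eD2m1) (hE20 : 0 ≤ E2) (hE2 : E2 ≤ val A.eD2m) (hE30 : 0 ≤ E3) (hE3 : E3 ≤ val A.eD2m_1) :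
    2 * u * (τr * ∑ j ∈ range A.Jt, envEp A j ^ 2
      + (Mb ^ 2 / 4 * E1 / (2 * A.m + 1) + Mb * Mb1 * E2 / (2 * A.m) + Mb1 ^ 2 * E3 / (2 * A.m - 1))) ≤
      val (stage2 A (stage1 A)).Bhi := by
  rw [stage2_Bhi]
  have hS := sum_envEp_sq_le A
  have hS0 : 0 ≤ ∑ j ∈ range A.Jt, envEp A j ^ 2 := sum_nonneg fun j _ => sq_nonneg _
  have h3 : τr * ∑ j ∈ range A.Jt, envEp A j ^ 2 ≤ val (mulU A.tau (sumSq (stage1 A).epRev 0)) := le_mulU hS0 hτ hS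
  have h4 : Mb ^ 2 ≤ val (mulU A.Mbar A.Mbar) := by rw [sq]; exact le_mulU hMb0 hMb hMb
  have h4' : Mb ^ 2 / 4 ≤ val (divUn (mulU A.Mbar A.Mbar) 4) := by
    have := le_divUn h4 (show 0 < 4 by norm_num); push_cast at this; exact this
  have h5 : Mb ^ 2 / 4 * E1 ≤ val (mulU (divUn (mulU A.Mbar A.Mbar) 4) A.eD2m1) := le_mulU hE10 h4' hE1
  have h6 : Mb ^ 2 / 4 * E1 / (2 * A.m + 1) ≤ val (divUn (mulU (divUn (mulU A.Mbar A.Mbar) 4) A.eD2m1) (2 * A.m + 1)) := by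
    have := le_divUn h5 (show 0 < 2 * A.m + 1 by omega); push_cast at this; exact this
  have h7 : Mb * Mb1 ≤ val (mulU A.Mbar A.Mbar1) := le_mulU hMb10 hMb hMb1
  have h8 : Mb * Mb1 * E2 ≤ val (mulU (mulU A.Mbar A.Mbar1) A.eD2m) := le_mulU hE20 h7 hE2
  have h9 : Mb * Mb1 * E2 / (2 * A.m) ≤ val (divUn (mulU (mulU A.Mbar A.Mbar1) A.eD2m) (2 * A.m)) := by
    have := le_divUn h8 (show 0 < 2 * A.m by omega); push_cast at this; exact this
  have h10 : Mb1 ^ 2 ≤ val (mulU A.Mbar1 A.Mbar1) := by rw [sq]; exact le_mulU hMb10 hMb1 hMb1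
  have h11 : Mb1 ^ 2 * E3 ≤ val (mulU (mulU A.Mbar1 A.Mbar1) A.eD2m_1) := le_mulU hE30 h10 hE3
  have h12 : Mb1 ^ 2 * E3 / (2 * A.m - 1) ≤ val (divUn (mulU (mulU A.Mbar1 A.Mbar1) A.eD2m_1) (2 * A.m - 1)) := by
    have := le_divUn h11 (show 0 < 2 * A.m - 1 by omega)
    have hc : ((2 * A.m - 1 : ℕ) : ℝ) = 2 * (A.m : ℝ) - 1 := by
      rw [Nat.cast_sub (by omega)]; push_cast; ring
    rw [hc] at this; exact this
  have h13 : τr * ∑ j ∈ range A.Jt, envEp A j ^ 2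
      + (Mb ^ 2 / 4 * E1 / (2 * A.m + 1) + Mb * Mb1 * E2 / (2 * A.m) + Mb1 ^ 2 * E3 / (2 * A.m - 1)) ≤
      val (mulU A.tau (sumSq (stage1 A).epRev 0)
        + (divUn (mulU (divUn (mulU A.Mbar A.Mbar) 4) A.eD2m1) (2 * A.m + 1)
          + divUn (mulU (mulU A.Mbar A.Mbar1) A.eD2m) (2 * A.m)
          + divUn (mulU (mulU A.Mbar1 A.Mbar1) A.eD2m_1) (2 * A.m - 1))) := by
    rw [val_add, val_add, val_add]; linarith
  have h14 : 2 * u ≤ val (2 * A.u1H) := by rw [val_nat_mul]; push_cast; linarith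
  have hm1 : (0 : ℝ) < 2 * (A.m : ℝ) - 1 := by
    have : (1 : ℝ) ≤ A.m := by exact_mod_cast hm
    linarith
  have t1 : 0 ≤ τr * ∑ j ∈ range A.Jt, envEp A j ^ 2 := mul_nonneg hτ0 hS0
  have t2 : 0 ≤ Mb ^ 2 / 4 * E1 / (2 * A.m + 1) := by positivity
  have t3 : 0 ≤ Mb * Mb1 * E2 / (2 * A.m) := by positivity
  have t4 : 0 ≤ Mb1 ^ 2 * E3 / (2 * A.m - 1) := div_nonneg (mul_nonneg (sq_nonneg _) hE30) hm1.le
  exact le_mulU (by linarith) h14 h13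

/-! ## (K3): the arch bound and the `C_T` prime part -/

/-- **(K3) arch**: `B̄·ē·t̄₀²/4 + Ā·c̄_A ≤ val arch` for any `B̄ ≤ val Bhi`, `Ā ≤ val Ahi`, `0 ≤ ē ≤ val et0half`, `0 ≤ t̄₀ ≤ val t0`,
`0 ≤ c̄_A ≤ val coefA` (D7 at the split point `t₀`). [this cell, TIER2-KERNEL-SPEC §5 (K3); THETA-CERT-cc6 D7] -/
theorem stage2_arch_sound (A : Inp) (st : St) {Br Ar e0 t0r cA : ℝ} (hB : Br ≤ val (stage2 A st).Bhi)
    (hAr : Ar ≤ val (stage2 A st).Ahi) (he0 : 0 ≤ e0) (he : e0 ≤ val A.et0half) (ht0 : 0 ≤ t0r) (ht : t0r ≤ val A.t0)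
    (hc0 : 0 ≤ cA) (hc : cA ≤ val A.coefA) :
    Br * e0 * t0r ^ 2 / 4 + Ar * cA ≤ val (stage2 A st).arch := by
  rw [stage2_arch]
  have h1 : Br * e0 ≤ val (mulU (stage2 A st).Bhi A.et0half) := le_mulU he0 hB he
  have h2 : Br * e0 * t0r ≤ val (mulU (mulU (stage2 A st).Bhi A.et0half) A.t0) := le_mulU ht0 h1 ht
  have h3 : Br * e0 * t0r * t0r ≤ val (mulU (mulU (mulU (stage2 A st).Bhi A.et0half) A.t0) A.t0) := le_mulU ht0 h2 ht
  have h4 : Br * e0 * t0r ^ 2 / 4 ≤ val (divUn (mulU (mulU (mulU (stage2 A st).Bhi A.et0half) A.t0) A.t0) 4) := by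
    have := le_divUn h3 (show 0 < 4 by norm_num); push_cast at this
    rw [sq, ← mul_assoc]; exact this
  have h5 : Ar * cA ≤ val (mulU (stage2 A st).Ahi A.coefA) := le_mulU hc0 hAr hc
  rw [val_add]; linarith

/-- **(K3) primesC**: `4M̄²ū₁/(2m+1)·Λ̄ ≤ val primesC` (D6, the `C_T` part, `Λ̄ ≤ val lamSum` any real `≥ 0`).
[this cell, TIER2-KERNEL-SPEC §5 (K3); THETA-CERT-cc6 D6] -/
theorem stage2_primesC_sound (A : Inp) (st : St) {u Mb Λ : ℝ} (hu0 : 0 ≤ u) (hu : u ≤ val A.u1H)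
    (hMb0 : 0 ≤ Mb) (hMb : Mb ≤ val A.Mbar) (hΛ0 : 0 ≤ Λ) (hΛ : Λ ≤ val A.lamSum) :
    4 * Mb ^ 2 * u / (2 * A.m + 1) * Λ ≤ val (stage2 A st).primesC := by
  rw [stage2_primesC]
  have h1 : Mb ^ 2 ≤ val (mulU A.Mbar A.Mbar) := by rw [sq]; exact le_mulU hMb0 hMb hMb
  have h2 : 4 * Mb ^ 2 ≤ val (4 * mulU A.Mbar A.Mbar) := by rw [val_nat_mul]; push_cast; linarith
  have h3 : 4 * Mb ^ 2 * u ≤ val (mulU (4 * mulU A.Mbar A.Mbar) A.u1H) := le_mulU hu0 h2 hu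
  have h4 : 4 * Mb ^ 2 * u / (2 * A.m + 1) ≤ val (divUn (mulU (4 * mulU A.Mbar A.Mbar) A.u1H) (2 * A.m + 1)) := by
    have := le_divUn h3 (show 0 < 2 * A.m + 1 by omega); push_cast at this; exact this
  exact le_mulU hΛ0 h4 hΛ

end Summit.RiemannHypothesis.RiemannHypothesis.Theorems.ThetaTier2
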